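/-
Copyright (c) 2026 the pub-hodgecm-mathlib formalisation cell (harness21).  Prover seat hodgecm-mathlib-LH4-p08 (g10), req620 Track A «(D-RAM) FOUR-FRAME» squad, helper lane
on h413 = stmt-HodgeConjecture-24833 (count-neutral).  Dealer∕pen LH4-plan WORD #118 ∕ β-BOARD LEDGER #9: (β-TABLE) (T3) «THE FINITE IDENTITY `oddLabelledBoxSum`» — ENGINE,
part 2, against the ★ (T1) v1 letter p861261.  2026-09-04.
-/
import Summits.HodgeConjecture.HodgeConjecture.Theorems.F0P3cDyRamOddLabelledBoxSumArith   -- ★ p861275 (LH4-p08 (g9)) part 1: telescope, support, even re-indexing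
import HarnessLib

/-!
# Crux `H413`, line LH4 «(D-RAM) FOUR-FRAME» — (β) road, (T3) ENGINE part 2: THE THREE PLANE TOTALS of the odd table (OWN ∕ PLAIN ∕ TWISTED slot of a tower),
# REST-SPLIT FORM of the ★ (T1) v1 letter `F0P3cDyRamOddLabelledBoxSumDefs.OddLabelledBoxSum` (p861261)

Cell `hodgecm-mathlib` (D-0151), FLOOR 0, crux item H413 = `stmt-HodgeConjecture-24833`, route `HCCMUnconditional`; squad F0∕P3c∕LH4; helper lane
`--supports stmt-HodgeConjecture-24833 --as helper` (count-neutral).  THEOREMS ONLY (no `def`, no instance, no notation, no `sorry`; default heartbeats); PURE ARITHMETIC over `ℚ`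
(no field, no place, no lattice).

In ★ (T1) v1 `OddLabelledBoxSum` (F0P3a-p01 (g37), p861261; LH4-p05 (g8)'s B2b-3 architecture) the box `[0, n₁+n₂+n₃]³` splits into the diagonal and the three planes of
the towers (★ `F0P3cDyRamStableCountBoxReindex.triple_sum_eq_diag_add_planes`).  On the plane of tower `X` (read depth `nX`; own slot carrying `r`, the two other slots `t > r`)
the letter PRESCRIBES the value of the table only on the NON-REST cells — the tower `r = 0` (`hT·`), the odd cells (`hzero`), and the CAPPED TUBE classes `r = 2ρ ≥ 2`,
`t + ℓ₀ = nX`, `r + 2 + ℓ₀ ≤ tb` (`tb` = the minimum of the two other depths; rows `hG·` in the one-slot cell `2ρ + m* ≤ C`, `hG·b`∕`hG3t` beyond it) — and books everything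
else (the REST shapes `2 ≤ r`, `2 ∣ r`, `2 ∣ t`, not a capped tube class: `IsRestShape`) into the single rest-sum row `hrest`.  So the (T3) engine evaluates, per plane and
per slot, the triangular sum of the NON-REST TABLE `ψ r t = [¬ rest(r,t)]·φ r t`:
* `line_total` (§1) — the read line of one tower in one non-own slot: tower term `c·x^{s∕2}` at `r = 0` plus the capped tube classes `c·x^{2ρ+s∕2−1}·F(nb − ℓ₀ − 2ρ)`,
  `F` the letter's bracket `(x − 1)·[2d + ℓ₀ + 2ρ ≤ nb] − [nb + 2 = 2d + ℓ₀ + 2ρ]` read at the slot's depth `nb`, telescope (★ `tower_slot_total`) to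
  `[¬(nb + 4 ≤ min nX tb + 2d)]·c·x^{nX − ℓ₀ − 1}` — ZERO iff the «flip class» `2ρ = nb − ℓ₀ − 2d + 2` lies in the tube, else the SURPLUS of the tower;
* `plane_total_own` (§2) — in the tower's own slot every non-rest cell is `0`, so `Σ_{r<t} ψ = 0`;
* `plane_total_plain` (§2) — PLAIN slot (`c = ω∕2`, the in-cell rows carry the pure factor `(q − 1)`, which IS the bracket there);
* `plane_total_twisted` (§2) — TWISTED slot (`c = ωm·ω∕2`; in the cell the ★ bracket in `s` IS the bracket in `nb − ℓ₀ − 2ρ` by the isosceles letter `hiso'`).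
The hypotheses `hT ∕ hGc ∕ hGb ∕ hZ ∕ hZ'` are LITERALLY the (T1) v1 binders `hT· ∕ hG· ∕ hG·b` (resp. `hG3t`, with the empty cell `C = 0`) ∕ `hzero`-rows after `fin_cases i` +
`simp only [Matrix.cons_val_…]`, and `hψ` is the rest indicator of the plane (`IsRestShape` on `![r,t,t]`, `![t,r,t]`, `![t,t,r]` under `r < t`); the assembly
`…OddLabelledBoxSum` (this seat, next file) shows it and adds `hrest`.

HONEST LABEL.  Count-neutral pure arithmetic; it pays no tier-0 row; the `hrest` row of (T1) v1 (κ-classes, glue classes, core-hanging strata) is where the open mathematics of the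
(β) table lives and is NOT touched here; (β)∕table∕T₊ OPEN; `HC_CM` is proved only modulo the 7 printed citations (2 remaining named inputs: hLiu418 = `stmt-HodgeConjecture-24832`,
h413 = `stmt-HodgeConjecture-24833`) until rung 0 closes.

## References
* [Kottwitz1986BaseChangeUnits] R. E. Kottwitz, *Base change for unit elements of Hecke algebras*, Compositio Math. 60 (1986), §1 pp. 240–241 (signed lattice counts by torus orbits).
* [Rogawski1990] J. D. Rogawski, *Automorphic Representations of Unitary Groups in Three Variables*, Ann. of Math. Stud. 123 (1990), §4.9 Prop. 4.9.1 (a)(b) p. 55, §4.10 p. 58.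
* [LanglandsShelstad1987] R. P. Langlands, D. Shelstad, *On the definition of transfer factors*, Math. Ann. 278 (1987), §3 (the κ-signs of the labelled table).
-/

set_option autoImplicit false

open Finset
open Summit.HodgeConjecture.HodgeConjecture.Cruxes.H413.F0P3cDyRamOddLabelledBoxSumArith
  (tower_slot_total triangle_sum_eq_line_add_row sum_range_eq_zero_add_sum_even)

namespace Summit.HodgeConjecture.HodgeConjecture.Cruxes.H413.F0P3cDyRamOddLabelledBoxSumPlanes

section ReadLine

/-- **THE READ LINE OF ONE TOWER IN ONE NON-OWN SLOT.**  Let `ψ r t` (`r < t ≤ B`) be a table on a plane vanishing off the tower `r = 0` (value `c·x^{s∕2}` at `s + ℓ₀ = nX`,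
`2 ∣ s`) and the capped tube classes `r = 2ρ ≥ 2`, `t + ℓ₀ = nX`, `2ρ + 2 + ℓ₀ ≤ tb` (value `c·x^{2ρ+s∕2−1}·F(nb − ℓ₀ − 2ρ)` with the boundary bracket
`F = (x − 1)·[2d + ℓ₀ + 2ρ ≤ nb] − [nb + 2 = 2d + ℓ₀ + 2ρ]`).  Then `Σ_{r<t≤B} ψ r t = [¬(nb + 4 ≤ min nX tb + 2d)]·c·x^{nX − ℓ₀ − 1}`: the line telescopes to `0`
when the flip class exists and to the tower's surplus otherwise. [folklore] -/
theorem line_total (ψ : ℕ → ℕ → ℚ) (x c : ℚ) {d nX nb tb B : ℕ} (hd : 2 ≤ d)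
    (hX : 3 * d - 2 + d % 2 ≤ nX) (hb : 3 * d - 2 + d % 2 ≤ nb) (htb0 : 3 * d - 2 + d % 2 ≤ tb)
    (hpX : nX % 2 = d % 2) (hpb : nb % 2 = d % 2) (hptb : tb % 2 = d % 2)
    (hseg : nX ≤ tb ∨ tb = nb) (hB : nX + tb ≤ B)
    (hT : ∀ s, 1 ≤ s → ψ 0 s = if s + d % 2 = nX ∧ 2 ∣ s then c * x ^ (s / 2) else 0)
    (hG : ∀ ρ s, 1 ≤ ρ → 1 ≤ s → ψ (2 * ρ) (2 * ρ + s) =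
        if 2 * ρ + s + d % 2 = nX ∧ 2 ∣ s ∧ 2 * ρ + 2 + d % 2 ≤ tb then
          c * x ^ (2 * ρ + s / 2 - 1) * ((if 2 * d + d % 2 + 2 * ρ ≤ nb then x - 1 else 0) - (if nb + 2 = 2 * d + d % 2 + 2 * ρ then 1 else 0))
        else 0)
    (hZ : ∀ r s, 1 ≤ r → ¬ 2 ∣ r → 1 ≤ s → ψ r (r + s) = 0) :
    ∑ r ∈ range (B + 1), ∑ t ∈ range (B + 1), (if r < t then ψ r t else 0) =
      if nb + 4 ≤ min nX tb + 2 * d then 0 else c * x ^ (nX - d % 2 - 1) := by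
  -- letters
  have hl : d % 2 ≤ 1 := by omega
  obtain ⟨N, hN⟩ : ∃ N, N = nX - d % 2 := ⟨_, rfl⟩
  have hNX : N + d % 2 = nX := by omega
  have hN2 : 2 ∣ N := by omega
  have hN4 : 4 ≤ N := by omega
  -- every cell off the read line `t = N` vanishes
  have hoff : ∀ r s, 1 ≤ s → r + s ≠ N → ψ r (r + s) = 0 := by
    intro r s hs hne
    rcases Nat.eq_zero_or_pos r with rfl | hr
    · rw [zero_add, hT s hs, if_neg]; rintro ⟨h, -⟩; omega
    · by_cases h2 : 2 ∣ r
      · obtain ⟨ρ, rfl⟩ := h2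
        rw [hG ρ s (by omega) hs, if_neg]; rintro ⟨h, -⟩; omega
      · exact hZ r s hr h2 hs
  rw [triangle_sum_eq_line_add_row ψ (N := N) (M := N) (by omega) (by omega) (fun r t hrt _ htN _ => by
    have := hoff r (t - r) (by omega) (by omega); rwa [Nat.add_sub_cancel' hrt.le] at this)]
  -- the row `r = N` beyond the line is empty
  have hrow : ∑ t ∈ range (B + 1), (if N < t ∧ t ≠ N then ψ N t else 0) = 0 := Finset.sum_eq_zero (fun t _ => by
    by_cases h : N < t ∧ t ≠ N
    · rw [if_pos h]; have := hoff N (t - N) (by omega) (by omega); rwa [Nat.add_sub_cancel' h.1.le] at this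
    · rw [if_neg h])
  rw [hrow, add_zero]
  -- the read line: `r = 0` (the tower) and the even `r = 2ρ ≤ K` (the strict tube, below the line)
  obtain ⟨K, hK⟩ : ∃ K, K = min nX tb - d % 2 - 2 := ⟨_, rfl⟩
  have hK2 : 2 ∣ K := by omega
  have hKN : K < N := by omega
  rw [sum_range_eq_zero_add_sum_even (fun r => ψ r N) hKN hK2
    (fun r hr h2 => by have := hZ r (N - r) (Nat.pos_of_ne_zero (by rintro rfl; exact h2 (dvd_zero 2))) h2 (by omega);
                       rwa [Nat.add_sub_cancel' hr.le] at this)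
    (fun r hKr hrN => by
      by_cases h2 : 2 ∣ r
      · obtain ⟨ρ, rfl⟩ := h2
        have := hG ρ (N - 2 * ρ) (by omega) (by omega)
        rw [Nat.add_sub_cancel' hrN.le] at this
        rw [this, if_neg]; rintro ⟨-, -, h⟩; omega
      · have := hZ r (N - r) (by omega) h2 (by omega); rwa [Nat.add_sub_cancel' hrN.le] at this)]
  -- the tower term
  rw [hT N (by omega), if_pos ⟨hNX, hN2⟩]
  -- the tube terms, uniformised to the telescope summand
  obtain ⟨S, hS⟩ : ∃ S, N = 2 * S := hN2
  obtain ⟨P, hP⟩ : ∃ P, 2 * P + 2 * d + d % 2 = nb := ⟨(nb - 2 * d - d % 2) / 2, by omega⟩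
  have hsum : ∀ ρ ∈ Icc 1 (K / 2), ψ (2 * ρ) N = c * x ^ (S + ρ - 1) *
      ((if 2 * d + d % 2 + 2 * ρ ≤ nb then x - 1 else 0) - (if nb + 2 = 2 * d + d % 2 + 2 * ρ then 1 else 0)) := by
    intro ρ hρ
    simp only [Finset.mem_Icc] at hρ
    have := hG ρ (N - 2 * ρ) hρ.1 (by omega)
    rw [Nat.add_sub_cancel' (by omega : 2 * ρ ≤ N)] at this
    rw [this, if_pos ⟨hNX, ⟨S - ρ, by omega⟩, by omega⟩, show 2 * ρ + (N - 2 * ρ) / 2 - 1 = S + ρ - 1 by omega]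
  rw [Finset.sum_congr rfl hsum, show N / 2 = S by omega, tower_slot_total x c S hP]
  -- read the flip condition and the surplus exponent
  by_cases hflip : nb + 4 ≤ min nX tb + 2 * d
  · rw [if_pos hflip, if_pos (by omega)]
  · rw [if_neg hflip, if_neg (by omega), show S + K / 2 = nX - d % 2 - 1 by omega]

end ReadLine

section Planes

/-- **OWN slot of a tower**: in the slot carrying the tower's own letter every NON-REST cell of the plane is `0` — the tower rows (`hT`), the capped tube rows in the cell
(`hGc`) and beyond it (`hGb`), the odd cells (`hZ`, `hZ'`) — so the non-rest table `ψ = [¬ rest]·φ` has triangular sum `0` (the κ-class of the special tower is a REST shape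
and lives in `hrest`). [folklore] -/
theorem plane_total_own (φ ψ : ℕ → ℕ → ℚ) {d nX tb C B : ℕ}
    (hψ : ∀ r t, r < t → ψ r t = if 2 ≤ r ∧ 2 ∣ r ∧ 2 ∣ t ∧ ¬ (t + d % 2 = nX ∧ r + 2 + d % 2 ≤ tb) then 0 else φ r t)
    (hT : ∀ s, 1 ≤ s → φ 0 s = 0)
    (hGc : ∀ ρ s, 1 ≤ ρ → 1 ≤ s → 2 * ρ + (d % 2 + 2 * d - 1) ≤ C → φ (2 * ρ) (2 * ρ + s) = 0)
    (hGb : ∀ ρ s, 1 ≤ ρ → C < 2 * ρ + (d % 2 + 2 * d - 1) → 2 * ρ + s + d % 2 = nX → 2 ∣ s → 2 * ρ + 2 + d % 2 ≤ tb →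
        φ (2 * ρ) (2 * ρ + s) = 0)
    (hZ : ∀ r s, 1 ≤ r → ¬ 2 ∣ r → 1 ≤ s → φ r (r + s) = 0)
    (hZ' : ∀ r s, 2 ≤ r → 2 ∣ r → ¬ 2 ∣ s → 1 ≤ s → φ r (r + s) = 0) :
    ∑ r ∈ range (B + 1), ∑ t ∈ range (B + 1), (if r < t then ψ r t else 0) = 0 := by
  refine Finset.sum_eq_zero fun r _ => Finset.sum_eq_zero fun t _ => ?_
  by_cases hrt : r < t
  · rw [if_pos hrt, hψ r t hrt]
    by_cases hR : 2 ≤ r ∧ 2 ∣ r ∧ 2 ∣ t ∧ ¬ (t + d % 2 = nX ∧ r + 2 + d % 2 ≤ tb)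
    · rw [if_pos hR]
    · rw [if_neg hR]
      obtain ⟨s, rfl⟩ : ∃ s, t = r + s := ⟨t - r, by omega⟩
      rcases Nat.eq_zero_or_pos r with rfl | hr
      · rw [zero_add]; exact hT s (by omega)
      · by_cases h2 : 2 ∣ r
        · obtain ⟨ρ, rfl⟩ := h2
          by_cases hs2 : 2 ∣ s
          · -- an even cell that is not a rest shape IS a capped tube class
            have hc : 2 * ρ + s + d % 2 = nX ∧ 2 * ρ + 2 + d % 2 ≤ tb := by
              by_contra h; exact hR ⟨by omega, by omega, by omega, h⟩
            by_cases hcell : 2 * ρ + (d % 2 + 2 * d - 1) ≤ C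
            · exact hGc ρ s (by omega) (by omega) hcell
            · exact hGb ρ s (by omega) (by omega) hc.1 hs2 hc.2
          · exact hZ' (2 * ρ) s (by omega) ⟨ρ, rfl⟩ hs2 (by omega)
        · exact hZ r s hr h2 (by omega)
  · rw [if_neg hrt]

/-- **PLAIN slot of a tower (read depth `nX`, bracket∕cell depth `nb`, tube bound `tb`, one-slot cell `2ρ + m* ≤ C`, `C ≤ nb`)**: the non-rest table `ψ = [¬ rest]·φ`
of the plane has triangular sum `[¬(nb + 4 ≤ min nX tb + 2d)]·ω∕2·q^{nX − ℓ₀ − 1}` — `0` when the flip class exists, else the tower's surplus.  The rows: tower `hT`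
(`ω∕2·q^{s∕2}` on `s + ℓ₀ = nX`), in-cell glued rows `hGc` (pure factor `(q − 1)`), capped tube rows beyond the cell `hGb` (the bracket read at `nb`), zeros `hZ` (odd `r`)
and `hZ'` (even `r ≥ 2`, odd `s`). [cite: Kottwitz1986BaseChangeUnits, §1 pp. 240–241] [cite: Rogawski1990, §4.9 Prop. 4.9.1 (a)(b) p. 55] -/
theorem plane_total_plain (φ ψ : ℕ → ℕ → ℚ) (q : ℕ) (ω : ℤ) {d nX nb tb C B : ℕ} (hd : 2 ≤ d)
    (hX : 3 * d - 2 + d % 2 ≤ nX) (hb : 3 * d - 2 + d % 2 ≤ nb) (htb0 : 3 * d - 2 + d % 2 ≤ tb)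
    (hpX : nX % 2 = d % 2) (hpb : nb % 2 = d % 2) (hptb : tb % 2 = d % 2)
    (hseg : nX ≤ tb ∨ tb = nb) (hC : C ≤ nb) (hB : nX + tb ≤ B)
    (hψ : ∀ r t, r < t → ψ r t = if 2 ≤ r ∧ 2 ∣ r ∧ 2 ∣ t ∧ ¬ (t + d % 2 = nX ∧ r + 2 + d % 2 ≤ tb) then 0 else φ r t)
    (hT : ∀ s, 1 ≤ s → φ 0 s = if s + d % 2 = nX ∧ 2 ∣ s then (ω : ℚ) / 2 * (q : ℚ) ^ (s / 2) else 0)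
    (hGc : ∀ ρ s, 1 ≤ ρ → 1 ≤ s → 2 * ρ + (d % 2 + 2 * d - 1) ≤ C → φ (2 * ρ) (2 * ρ + s) =
        if 2 * ρ + s + d % 2 = nX ∧ 2 ∣ s ∧ 2 * ρ ≤ tb then (ω : ℚ) / 2 * (((q : ℚ) - 1) * (q : ℚ) ^ (2 * ρ + s / 2 - 1)) else 0)
    (hGb : ∀ ρ s, 1 ≤ ρ → C < 2 * ρ + (d % 2 + 2 * d - 1) → 2 * ρ + s + d % 2 = nX → 2 ∣ s → 2 * ρ + 2 + d % 2 ≤ tb →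
        φ (2 * ρ) (2 * ρ + s) = (ω : ℚ) / 2 * (q : ℚ) ^ (2 * ρ + s / 2 - 1) *
          ((if 2 * d + d % 2 + 2 * ρ ≤ nb then (q : ℚ) - 1 else 0) - (if nb + 2 = 2 * d + d % 2 + 2 * ρ then 1 else 0)))
    (hZ : ∀ r s, 1 ≤ r → ¬ 2 ∣ r → 1 ≤ s → φ r (r + s) = 0)
    (hZ' : ∀ r s, 2 ≤ r → 2 ∣ r → ¬ 2 ∣ s → 1 ≤ s → φ r (r + s) = 0) :
    ∑ r ∈ range (B + 1), ∑ t ∈ range (B + 1), (if r < t then ψ r t else 0) =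
      if nb + 4 ≤ min nX tb + 2 * d then 0 else (ω : ℚ) / 2 * (q : ℚ) ^ (nX - d % 2 - 1) := by
  have hl : d % 2 ≤ 1 := by omega
  refine line_total ψ (q : ℚ) ((ω : ℚ) / 2) hd hX hb htb0 hpX hpb hptb hseg hB ?_ ?_ ?_
  · intro s hs
    rw [hψ 0 s (by omega), if_neg (by rintro ⟨h, -⟩; omega), hT s hs]
  · intro ρ s hρ hs
    rw [hψ (2 * ρ) (2 * ρ + s) (by omega)]
    by_cases hcond : 2 * ρ + s + d % 2 = nX ∧ 2 ∣ s ∧ 2 * ρ + 2 + d % 2 ≤ tb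
    · obtain ⟨h1, h2, h3⟩ := hcond
      rw [if_neg (show ¬ (2 ≤ 2 * ρ ∧ 2 ∣ 2 * ρ ∧ 2 ∣ 2 * ρ + s ∧ ¬ (2 * ρ + s + d % 2 = nX ∧ 2 * ρ + 2 + d % 2 ≤ tb)) from
            fun h => h.2.2.2 ⟨h1, h3⟩),
        if_pos (show 2 * ρ + s + d % 2 = nX ∧ 2 ∣ s ∧ 2 * ρ + 2 + d % 2 ≤ tb from ⟨h1, h2, h3⟩)]
      by_cases hcell : 2 * ρ + (d % 2 + 2 * d - 1) ≤ C
      · rw [hGc ρ s hρ hs hcell, if_pos ⟨h1, h2, by omega⟩, if_pos (by omega), if_neg (by omega)]; ring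
      · exact hGb ρ s hρ (by omega) h1 h2 h3
    · rw [if_neg hcond]
      by_cases h2 : 2 ∣ s
      · rw [if_pos ⟨by omega, by omega, by omega, fun h => hcond ⟨by omega, h2, h.2⟩⟩]
      · rw [if_neg (fun h => h2 (by omega)), hZ' (2 * ρ) s (by omega) ⟨ρ, rfl⟩ h2 hs]
  · intro r s hr h2 hs
    rw [hψ r (r + s) (by omega), if_neg (fun h => h2 h.2.1), hZ r s hr h2 hs]

/-- **TWISTED slot of a tower** (the slot carrying `ω(−1) = ωm`; read depth `nX`, bracket depth `nb` = the THIRD depth, tube bound `tb`, one-slot cell `2ρ + m* ≤ C` with the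
isosceles letter `hiso' : nX = nb ∨ (C ≤ nX ∧ C ≤ nb)` that reads the in-cell ★ bracket in `s` as the bracket in `nb − ℓ₀ − 2ρ`): the non-rest table `ψ = [¬ rest]·φ` of the
plane has triangular sum `[¬(nb + 4 ≤ min nX tb + 2d)]·ωm·ω∕2·q^{nX − ℓ₀ − 1}`. [cite: Kottwitz1986BaseChangeUnits, §1 pp. 240–241] [cite: Rogawski1990, §4.9 Prop. 4.9.1 (a)(b) p. 55] -/
theorem plane_total_twisted (φ ψ : ℕ → ℕ → ℚ) (q : ℕ) (ω ωm : ℤ) {d nX nb tb C B : ℕ} (hd : 2 ≤ d)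
    (hX : 3 * d - 2 + d % 2 ≤ nX) (hb : 3 * d - 2 + d % 2 ≤ nb) (htb0 : 3 * d - 2 + d % 2 ≤ tb)
    (hpX : nX % 2 = d % 2) (hpb : nb % 2 = d % 2) (hptb : tb % 2 = d % 2)
    (hseg : nX ≤ tb ∨ tb = nb) (hiso' : nX = nb ∨ (C ≤ nX ∧ C ≤ nb)) (hB : nX + tb ≤ B)
    (hψ : ∀ r t, r < t → ψ r t = if 2 ≤ r ∧ 2 ∣ r ∧ 2 ∣ t ∧ ¬ (t + d % 2 = nX ∧ r + 2 + d % 2 ≤ tb) then 0 else φ r t)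
    (hT : ∀ s, 1 ≤ s → φ 0 s = if s + d % 2 = nX ∧ 2 ∣ s then (ωm : ℚ) * (ω : ℚ) / 2 * (q : ℚ) ^ (s / 2) else 0)
    (hGc : ∀ ρ s, 1 ≤ ρ → 1 ≤ s → 2 * ρ + (d % 2 + 2 * d - 1) ≤ C → φ (2 * ρ) (2 * ρ + s) =
        if 2 * ρ + s + d % 2 = nX ∧ 2 ∣ s ∧ 2 * ρ ≤ tb then
          (ω : ℚ) / 2 * ((ωm : ℚ) * (q : ℚ) ^ (2 * ρ + s / 2 - 1) * ((if 2 * d ≤ s then (q : ℚ) - 1 else 0) - (if s + 2 = 2 * d then 1 else 0))) else 0)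
    (hGb : ∀ ρ s, 1 ≤ ρ → C < 2 * ρ + (d % 2 + 2 * d - 1) → 2 * ρ + s + d % 2 = nX → 2 ∣ s → 2 * ρ + 2 + d % 2 ≤ tb →
        φ (2 * ρ) (2 * ρ + s) = (ω : ℚ) / 2 * (q : ℚ) ^ (2 * ρ + s / 2 - 1) *
          ((ωm : ℚ) * ((if 2 * d + d % 2 + 2 * ρ ≤ nb then (q : ℚ) - 1 else 0) - (if nb + 2 = 2 * d + d % 2 + 2 * ρ then 1 else 0))))
    (hZ : ∀ r s, 1 ≤ r → ¬ 2 ∣ r → 1 ≤ s → φ r (r + s) = 0)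
    (hZ' : ∀ r s, 2 ≤ r → 2 ∣ r → ¬ 2 ∣ s → 1 ≤ s → φ r (r + s) = 0) :
    ∑ r ∈ range (B + 1), ∑ t ∈ range (B + 1), (if r < t then ψ r t else 0) =
      if nb + 4 ≤ min nX tb + 2 * d then 0 else (ωm : ℚ) * (ω : ℚ) / 2 * (q : ℚ) ^ (nX - d % 2 - 1) := by
  have hl : d % 2 ≤ 1 := by omega
  refine line_total ψ (q : ℚ) ((ωm : ℚ) * (ω : ℚ) / 2) hd hX hb htb0 hpX hpb hptb hseg hB ?_ ?_ ?_
  · intro s hs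
    rw [hψ 0 s (by omega), if_neg (by rintro ⟨h, -⟩; omega), hT s hs]
  · intro ρ s hρ hs
    rw [hψ (2 * ρ) (2 * ρ + s) (by omega)]
    by_cases hcond : 2 * ρ + s + d % 2 = nX ∧ 2 ∣ s ∧ 2 * ρ + 2 + d % 2 ≤ tb
    · obtain ⟨h1, h2, h3⟩ := hcond
      rw [if_neg (show ¬ (2 ≤ 2 * ρ ∧ 2 ∣ 2 * ρ ∧ 2 ∣ 2 * ρ + s ∧ ¬ (2 * ρ + s + d % 2 = nX ∧ 2 * ρ + 2 + d % 2 ≤ tb)) from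
            fun h => h.2.2.2 ⟨h1, h3⟩),
        if_pos (show 2 * ρ + s + d % 2 = nX ∧ 2 ∣ s ∧ 2 * ρ + 2 + d % 2 ≤ tb from ⟨h1, h2, h3⟩)]
      by_cases hcell : 2 * ρ + (d % 2 + 2 * d - 1) ≤ C
      · -- in the cell the ★ bracket in `s` is the bracket in `nb − ℓ₀ − 2ρ` (isosceles letter)
        rw [hGc ρ s hρ hs hcell, if_pos ⟨h1, h2, by omega⟩,
          if_congr (show 2 * d ≤ s ↔ 2 * d + d % 2 + 2 * ρ ≤ nb by rcases hiso' with h | h <;> omega) rfl rfl,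
          if_congr (show s + 2 = 2 * d ↔ nb + 2 = 2 * d + d % 2 + 2 * ρ by rcases hiso' with h | h <;> omega) rfl rfl]
        ring
      · rw [hGb ρ s hρ (by omega) h1 h2 h3]; ring
    · rw [if_neg hcond]
      by_cases h2 : 2 ∣ s
      · rw [if_pos ⟨by omega, by omega, by omega, fun h => hcond ⟨by omega, h2, h.2⟩⟩]
      · rw [if_neg (fun h => h2 (by omega)), hZ' (2 * ρ) s (by omega) ⟨ρ, rfl⟩ h2 hs]
  · intro r s hr h2 hs
    rw [hψ r (r + s) (by omega), if_neg (fun h => h2 h.2.1), hZ r s hr h2 hs]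

end Planes

end Summit.HodgeConjecture.HodgeConjecture.Cruxes.H413.F0P3cDyRamOddLabelledBoxSumPlanes
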